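import Summits.AtomisticToContinuum.HydrodynamicLimit.Theses.OneFlightGossipEngine
import Literature.MathematicalPhysics.KineticTheory.HardSphereEulerProofs
import Literature.Barriers.AtomisticToContinuum.HighMomentumCutoffNarrow

/-!
# Disproof workfile for the crux `EnergyCurrentTails` (stmt-AtomisticToContinuum-9235)

Route decl: `Summit.AtomisticToContinuum.HydrodynamicLimit.Theses.OneFlightGossipEngine.EnergyCurrentTails`
(shared verbatim by the routes WarmColdDichotomy, BallwiseInvariantReferences, AnosovDiceHopf,
TwoClocks, JaynesSqueeze, PesinPricing, ExpTailStaging; ex-stmt-3655 of KineticWindows).  Standing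
adversary: refuter-cdisprove-stmt-AtomisticToContinuum-9235-0 (cycle 1, 2026-08-16).  Prose lives
in docstrings; the file is sorry-free (`lean check` rc 0, 0 warnings).

## The statement, read back

For all continuous profiles `a₀ > 0`, `θ₀ > 0`, `u₀` on `𝕋³` there is `σ₀ > 0` such that for all
`0 < σ < σ₀`, every `T`, every classical hs-Euler solution `(ρ, u, θ)` on `[0, T)` and every family
of hard-sphere flows `Φ N` (`N + 1` spheres of diameter `σ(N+1)^{-1/3}`): IF the empirical fields of
the local Gibbs laws `λ_N = localGibbsLaw σ a₀ u₀ θ₀ N (Φ N)` converge in probability at `t = 0` to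
`(ρ, ρu, E)(0)`, THEN for every `t ∈ [0, T)` and `ε > 0` there are `M` and `N₀` with
`E_{λ_N}[(N+1)⁻¹ ∑ᵢ 𝟙{M < |vᵢ(s)|} |vᵢ(s)|³] ≤ ε` for all `N ≥ N₀` and all `s ∈ [0, t]`
(`vᵢ(s) = ((Φ N).flow s z i).2`; the integrand is this file's `cubicTail`, `cubicTail_eq`).

Coercion / junk audit (all benign): `∫⁻ ∘ ENNReal.ofReal` of a nonnegative real; `λ_N` is the
flow-free `localGibbsMeasure` (`localGibbsLaw_eq`), a probability measure for `σ ≤ 1/2`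
(`isProbabilityMeasure_localGibbsLaw`) and the ZERO measure once the spheres cannot fit (then the
conclusion is trivially true, never false); the flow is junk only off a Liouville-conull invariant
set and `λ_N ≪` Liouville; `M : ℝ` of either sign (harmless); quantifier order `∀ ε ∃ M ∃ N₀ ∀ N ∀ s`
is the correct uniform-integrability order; `T ≤ 0` is vacuous.  STRUCTURAL REMARK for provers and
planners: the Euler data `(ρ, u, θ)` enter the conclusion ONLY through the horizon `t < T`, and the
LLN hypothesis at `t = 0` enters nothing else — the item is a pure a priori estimate on
`(profiles, σ, Φ, t)`; since hard-sphere flows agree a.e. (`HardSphereFlow.flow_eq_ae_holds`) the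
dependence of `M` on `Φ` is fictitious too.

## Findings (cycle 1) — NO KILL, no misstatement

1. JUNK-MODEL ATTACK fails: `HardSphereFlow.isTrajectory` pins free flight + elastic binary
   collisions on a conull invariant good set, `λ_N ≪` Liouville, flows are a.e. unique
   (`Literature/Analysis/FluidPDE/HardSphereUniqueness.lean`), the collision law `reflectVel`
   conserves `|v|² + |w|²`; no freedom in `Φ` can be exploited.
2. DEGENERATE REGIMES fail: `N + 1 = 1` (free flight, tails constant in `s`); `N + 1 = 2` (the pair's
   cubic tail is bounded by `(|v|²+|w|²)^{3/2}`, conserved); `σ` large (law `= 0`, trivially true);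
   `t = 0` (one-body Gaussian tail, true WITHOUT `N₀`); GLOBAL EQUILIBRIUM (constant profiles — the
   only data for which `T` is unbounded): TRUE and provable now in the tree — the homogeneous law has
   density `Z⁻¹ 𝟙_D exp(-(∑|vᵢ|² - 2u₀·∑vᵢ + (N+1)|u₀|²)/2θ₀)`, a function of the conserved energy
   and momentum (`IsHardSphereTrajectory.configEnergy_eq_holds`, `HardSphereMomentumConservation`),
   hence is invariant under EVERY hard-sphere flow (Liouville `measurePreserving` + pointwise
   invariance of the density on the good set, cf. `…Theorems.AprioriBounds.Negative.FlowInvariance`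
   for the regularised flow), so `E tail(s) = E tail(0)` = the one-body drifted-Gaussian cubic tail,
   `→ 0` as `M → ∞` uniformly in `N` and `s`.  CHECKED for `u₀ = 0`, `0 < σ < 1/2`, EVERY flow family:
   companion file `EquilibriumRung.lean` in this crux directory (sorry-free, standard axioms;
   `energyCurrentTails_homogeneous`: `∃ M ∀ N ∀ s, E tail ≤ ε`, explicitly `M = E|w|⁴/ε + 1`, via
   `flow_eq_ae_holds` + `measurePreserving_regFlow_localGibbsMeasure` + `lintegral_localGibbsMeasure`).
   It is positive, so it travels as item evidence (candidate proof of an equilibrium rung), not as a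
   landing from this seat.
3. LOAD-BEARING HYPOTHESES (checked, §3–§4): (a) the RANDOMNESS of the data — the sure version over
   configurations of energy `≤ E₀` per particle is false (`energyCurrentTails_false_without_randomness`,
   witness: one sphere with speed `√(N+1)`; also INSIDE the hard-sphere domain at every `σ ≤ 1/2`,
   `energyCurrentTails_false_without_randomness_inDomain`); (b) the GAUSSIAN form of the law beyond what energy and
   entropy see — cubic UI does not follow from quadratic (kinetic-energy) UI of the laws
   (`energyCurrentTails_false_of_quadraticUI_only`, two-point focusing laws with weight
   `(N+1)^{-1/2}`: quadratic tails `→ 0` at every cut-off, cubic tails `≡ 1`).  NOT load-bearing (paper,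
   item 2): the Euler solution, the LLN hypothesis, `N₀` (at `t = 0` and at equilibrium), `σ₀`.
4. NATURAL STRENGTHENINGS REFUTED (checked): (c) no pathwise maximum principle — one elastic collision
   transfers ALL the pair's energy to one sphere (`reflectVel_focus`: impact direction `e₀`,
   `(-a e₀, a e₁) ↦ (0, a e₁ - a e₀)`, speed `a ↦ √2 a`), so the cubic tail of a colliding pair can
   jump from `0` to `2√2 a³` (`cubicTail_not_nonincreasing`); iterating (CHECKED, §5b `focusing_tree`:
   velocity kinematics via `Reach`, perpendicular equal-length splits `exists_perp_split`) a binary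
   collision tree focuses the energy of `2^k` spheres of speed `a` on ONE sphere of speed `2^{k/2} a`,
   all others stopped — kinematically the focusing scenario of the planners' "why it might fail"
   EXISTS for every focusing factor; only its Liouville weight under the evolved law can save the crux; (d) the exponential-moment (window-LD / entropy-inequality)
   currency is dead for this functional: one body (`not_exists_expCubicMoment_maxwellian`, the
   catalogued `HighMomentumCutoffBarrierNarrow` conjunct (2)) and `N` bodies at `t = 0` under EVERY
   local Gibbs law (`lintegral_exp_sum_tail3_localGibbsMeasure_eq_top`: `E_{λ_N} exp(β∑ᵢ tailᵢ) = ∞`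
   for all `β > 0`, `M`, `N`, `σ ≤ 1/2`), whence `energyCurrentTailsExpMoment_false`.  Consequence
   for the route: EngineDock must consume EnergyCurrentTails as UNIFORM INTEGRABILITY (Chebyshev /
   polynomial currency), never inside `Λ_τ(β)`.
5. WHY IT RESISTS (substance): a counterexample needs the deterministic PRE-SHOCK dynamics from local
   Gibbs data to keep cubic mass `≥ ε₀` beyond every cut-off — a power-law one-body velocity tail or
   energy `≳ N^{2/3}` focused on `o(N)` spheres with non-vanishing probability.  The only a priori
   tools (energy/momentum conservation, Liouville invariance, `H(f_s | g_N) ≤ CN`, even the pointwise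
   bound `f_s ≤ K^{N+1} g_N` for `θ̄ > max θ₀`) are blind to it (§3, §4, §6: they need `M ≍ √N`), so no
   PROOF is in sight.  Sharpest paper form of the blindness (not typed: needs conditioning + `klDiv`
   on phase space): `P_N = (1 - q_N) λ_N + q_N λ_N( · | |v₀| > √(N+1))`, `q_N = (N+1)^{-1/4}`, has
   `dP_N/dλ_N ≤ K^{N+1}`, `H(P_N | λ_N) ≤ q_N (N+1)/(2 min θ₀) + log 2 = O(N^{3/4}) = o(N)`, the same
   LLN at `t = 0`, quadratic tails `≤ T₂(M) + 2 q_N` (Gaussian quadratic tail plus `o(1)`: quadratic UI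
   holds), and cubic tail `≥ q_N √(N+1) = (N+1)^{1/4} → ∞` at every cut-off — so no argument factoring through (LLN at 0, `H = o(N)`, energy, Liouville) can
   prove the crux; its one-body shadow is the typed support `ExpTailStaging.EntropyBlindToCubicMoments`
   (stmt-11522).  Truth is another matter: every kinetic description of the pre-shock regime (Enskog/Boltzmann moment
   propagation à la Povzner, Maxwellian upper bounds — Bobylev 1997, Pulvirenti–Wennberg 1997,
   Gamba–Panferov–Villani 2009; fast-sphere cascades SPREAD energy — Antal–Krapivsky–Redner 2008;
   pointers from memory, literature services degraded this session) predicts thin tails, and at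
   equilibrium the focusing trees of (c) have exactly Gaussian weight.  Verdict: open, not false.
6. SEARCHES: `ledger negatives` (no entry for 9235); barrier catalogue — `HighMomentumCutoff(Narrow)`
   is the relevant entry and is USED in §6; `lit search` ×3 / `lit galaxy search --star all` ×4:
   search-degraded (searchd fts unavailable, OpenAlex/S2 HTTP 429, galaxy 0 rows).

## Landed negative lemmas (namespace `Summit.AtomisticToContinuum.HydrodynamicLimit.Theorems.EnergyCurrentTailsNegative`)
* `…Theorems.EnergyCurrentTails.Negative.CubicTailExpMoment` — p82390 ACCEPTED (commit 3ffeb756): §1, §6,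
  §6b (`tail3`, `cubicTail`, `lintegral_exp_tail3_gaussMeasure_eq_top`,
  `lintegral_exp_sum_tail3_localGibbsMeasure_eq_top`, `EnergyCurrentTailsExpMoment`,
  `energyCurrentTailsExpMoment_false`) — importable now.
* `…Theorems.EnergyCurrentTails.Negative.FocusingLaws` — p95055 ACCEPTED (commit 9a3b4579): §2–§4
  (`fastConfig`, `EnergyCurrentTailsSure[InDomain]`, `twoPointLaw`, `EnergyCurrentTailsOfQuadraticUI`).
* `…Theorems.EnergyCurrentTails.Negative.CollisionFocusing` — p95063 ACCEPTED (commit 3cd602e4): §5–§5b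
  (`reflectVel_focus`, `reflectVel_perp`, `Reach`, `focusing_tree`, `CubicTailNonincreasing`).
* Positive companion (evidence only, not a landing): `EquilibriumRung.lean` in this crux directory.

## Index
* §1 `tail3`, `cubicTail` (= the crux integrand), measurability.
* §2 `fastConfig` (one fast sphere), `exists_sqrt_gt`.
* §3 `EnergyCurrentTailsSure`, `energyCurrentTails_false_without_randomness`; §3b the same inside the
  hard-sphere domain: `EnergyCurrentTailsSureInDomain`, `energyCurrentTails_false_without_randomness_inDomain`.
* §4 `EnergyCurrentTailsOfQuadraticUI`, `twoPointLaw`, `energyCurrentTails_false_of_quadraticUI_only`.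
* §5 `reflectVel_focus`, `norm_sq_focus`, `reflectVel_perp` (iterable focusing step), `norm_sq_add_perp`;
  §5b `Reach` (pair-collision reachability of velocity multisets), `exists_perp_split`,
  `focusing_tree` (`2^k` spheres of speed `|V|/2^{k/2}` ↦ one sphere of velocity `V`, rest at rest);
  `CubicTailNonincreasing`, `cubicTail_not_nonincreasing`.
* §6 `not_exists_expCubicMoment_maxwellian`; §6b `lintegral_exp_tail3_gaussMeasure_eq_top`,
  `lintegral_exp_sum_tail3_localGibbsMeasure_eq_top`, `EnergyCurrentTailsExpMoment`,
  `energyCurrentTailsExpMoment_false`.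
* §7 (prose) next attacks / targets.
-/

noncomputable section

open MeasureTheory Filter Set Topology
open scoped ENNReal

namespace Summit.AtomisticToContinuum.HydrodynamicLimit.Cruxes.EnergyCurrentTails.Disproof

open Literature.MathematicalPhysics.KineticTheory Literature.Analysis.FluidPDE

/-! ## §1 The crux functional -/

/-- One-particle cubic tail `𝟙{M < |v|} |v|³` (the crux's summand). -/
def tail3 (M : ℝ) (v : V3) : ℝ := Set.indicator {v : V3 | M < ‖v‖} (fun v => ‖v‖ ^ 3) v

/-- One-particle quadratic (kinetic-energy) tail `𝟙{M < |v|} |v|²`. -/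
def tail2 (M : ℝ) (v : V3) : ℝ := Set.indicator {v : V3 | M < ‖v‖} (fun v => ‖v‖ ^ 2) v

/-- The crux's empirical cubic tail `(N+1)⁻¹ ∑ᵢ 𝟙{M < |vᵢ|} |vᵢ|³`. -/
def cubicTail (N : ℕ) (M : ℝ) (z : Config (N + 1) (Fin 3) T3) : ℝ :=
  ((N : ℝ) + 1)⁻¹ * ∑ i : Fin (N + 1), tail3 M (z i).2

/-- The empirical quadratic tail `(N+1)⁻¹ ∑ᵢ 𝟙{M < |vᵢ|} |vᵢ|²`. -/
def quadTail (N : ℕ) (M : ℝ) (z : Config (N + 1) (Fin 3) T3) : ℝ :=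
  ((N : ℝ) + 1)⁻¹ * ∑ i : Fin (N + 1), tail2 M (z i).2

/-- `cubicTail` is literally the crux's integrand. -/
theorem cubicTail_eq (N : ℕ) (M : ℝ) (z : Config (N + 1) (Fin 3) T3) :
    cubicTail N M z = ((N : ℝ) + 1)⁻¹ *
      ∑ i : Fin (N + 1), Set.indicator {v : V3 | M < ‖v‖} (fun v => ‖v‖ ^ 3) (z i).2 := rfl

theorem tail3_nonneg (M : ℝ) (v : V3) : 0 ≤ tail3 M v :=
  Set.indicator_nonneg (fun w _ => by positivity) v

theorem tail2_nonneg (M : ℝ) (v : V3) : 0 ≤ tail2 M v :=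
  Set.indicator_nonneg (fun w _ => by positivity) v

theorem tail3_of_lt {M : ℝ} {v : V3} (h : M < ‖v‖) : tail3 M v = ‖v‖ ^ 3 :=
  Set.indicator_of_mem (show v ∈ {v : V3 | M < ‖v‖} from h) _

theorem tail3_of_le {M : ℝ} {v : V3} (h : ‖v‖ ≤ M) : tail3 M v = 0 :=
  Set.indicator_of_notMem (show v ∉ {v : V3 | M < ‖v‖} from fun h' => (not_lt.2 h) h') _

theorem tail2_le (M : ℝ) (v : V3) : tail2 M v ≤ ‖v‖ ^ 2 :=
  Set.indicator_le_self' (fun _ _ => by positivity) v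

theorem tail3_zero (M : ℝ) (hM : 0 ≤ M) : tail3 M (0 : V3) = 0 :=
  tail3_of_le (by simpa using hM)

theorem tail2_zero (M : ℝ) (hM : 0 ≤ M) : tail2 M (0 : V3) = 0 := by
  unfold tail2
  exact Set.indicator_of_notMem (by simpa using hM) _

theorem cubicTail_nonneg (N : ℕ) (M : ℝ) (z : Config (N + 1) (Fin 3) T3) : 0 ≤ cubicTail N M z :=
  mul_nonneg (by positivity) (Finset.sum_nonneg fun i _ => tail3_nonneg M _)

theorem quadTail_nonneg (N : ℕ) (M : ℝ) (z : Config (N + 1) (Fin 3) T3) : 0 ≤ quadTail N M z :=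
  mul_nonneg (by positivity) (Finset.sum_nonneg fun i _ => tail2_nonneg M _)

theorem measurable_tail3 (M : ℝ) : Measurable (tail3 M) := by
  unfold tail3
  exact (measurable_norm.pow_const 3).indicator (measurableSet_lt measurable_const measurable_norm)

theorem measurable_cubicTail (N : ℕ) (M : ℝ) : Measurable (cubicTail N M) := by
  unfold cubicTail
  refine Measurable.const_mul (Finset.measurable_sum _ fun i _ => ?_) _
  exact (measurable_tail3 M).comp (measurable_snd.comp (measurable_pi_apply i))

/-! ## §2 The focusing configuration: one fast sphere -/

/-- The unit vector `e_k` of `ℝ³`. -/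
def e (k : Fin 3) : V3 := EuclideanSpace.single k 1

@[simp] theorem norm_e (k : Fin 3) : ‖e k‖ = 1 := by
  simp [e]

/-- The focusing configuration: all spheres at rest except sphere `0`, which moves with speed
`V` along `e₀` (positions irrelevant, all at the origin). -/
def fastConfig (N : ℕ) (V : ℝ) : Config (N + 1) (Fin 3) T3 :=
  fun i => ((0 : T3), if i = 0 then V • e 0 else 0)

/-- The rest configuration. -/
def restConfig (N : ℕ) : Config (N + 1) (Fin 3) T3 := fun _ => ((0 : T3), (0 : V3))

theorem sum_fastConfig {N : ℕ} (V : ℝ) (g : V3 → ℝ) (hg : g 0 = 0) :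
    ∑ i : Fin (N + 1), g ((fastConfig N V i).2) = g (V • e 0) := by
  rw [Finset.sum_eq_single (0 : Fin (N + 1))]
  · simp [fastConfig]
  · intro i _ hi
    simp [fastConfig, hi, hg]
  · intro h; exact absurd (Finset.mem_univ _) h

theorem norm_smul_e (V : ℝ) (hV : 0 ≤ V) : ‖V • e 0‖ = V := by
  rw [norm_smul, norm_e, mul_one, Real.norm_of_nonneg hV]

theorem energy_fastConfig (N : ℕ) (V : ℝ) (hV : 0 ≤ V) :
    ((N : ℝ) + 1)⁻¹ * ∑ i : Fin (N + 1), ‖(fastConfig N V i).2‖ ^ 2 = ((N : ℝ) + 1)⁻¹ * V ^ 2 := by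
  rw [sum_fastConfig V (fun v => ‖v‖ ^ 2) (by simp), norm_smul_e V hV]

theorem cubicTail_fastConfig {N : ℕ} {V M : ℝ} (hM : 0 ≤ M) (hV : M < V) :
    cubicTail N M (fastConfig N V) = ((N : ℝ) + 1)⁻¹ * V ^ 3 := by
  unfold cubicTail
  rw [sum_fastConfig V (tail3 M) (tail3_zero M hM),
    tail3_of_lt (by rwa [norm_smul_e V (hM.trans hV.le)]), norm_smul_e V (hM.trans hV.le)]

theorem quadTail_fastConfig_le {N : ℕ} {V M : ℝ} (hM : 0 ≤ M) (hV : 0 ≤ V) :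
    quadTail N M (fastConfig N V) ≤ ((N : ℝ) + 1)⁻¹ * V ^ 2 := by
  unfold quadTail
  rw [sum_fastConfig V (tail2 M) (tail2_zero M hM)]
  refine mul_le_mul_of_nonneg_left ?_ (by positivity)
  calc tail2 M (V • e 0) ≤ ‖V • e 0‖ ^ 2 := tail2_le M _
    _ = V ^ 2 := by rw [norm_smul_e V hV]

theorem cubicTail_restConfig (N : ℕ) {M : ℝ} (hM : 0 ≤ M) : cubicTail N M (restConfig N) = 0 := by
  unfold cubicTail restConfig
  simp [tail3_zero M hM]

theorem quadTail_restConfig (N : ℕ) {M : ℝ} (hM : 0 ≤ M) : quadTail N M (restConfig N) = 0 := by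
  unfold quadTail restConfig
  simp [tail2_zero M hM]

/-- With `V = √(N+1)` (energy `1` per particle) the cubic tail of the focusing configuration is
`√(N+1)` as soon as the cut-off is below the fast speed. -/
theorem cubicTail_fastConfig_sqrt {N : ℕ} {M : ℝ} (hM : 0 ≤ M) (hV : M < Real.sqrt ((N : ℝ) + 1)) :
    cubicTail N M (fastConfig N (Real.sqrt ((N : ℝ) + 1))) = Real.sqrt ((N : ℝ) + 1) := by
  rw [cubicTail_fastConfig hM hV]
  have hN : (0 : ℝ) ≤ (N : ℝ) + 1 := by positivity
  have hN' : (N : ℝ) + 1 ≠ 0 := by positivity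
  have h3 : Real.sqrt ((N : ℝ) + 1) ^ 3 = ((N : ℝ) + 1) * Real.sqrt ((N : ℝ) + 1) := by
    rw [pow_succ, Real.sq_sqrt hN]
  rw [h3, ← mul_assoc, inv_mul_cancel₀ hN', one_mul]

/-- A natural number beyond `N₀` whose successor has square root above `M` (and above `2`). -/
theorem exists_sqrt_gt (M : ℝ) (N₀ : ℕ) :
    ∃ N : ℕ, N₀ ≤ N ∧ M < Real.sqrt ((N : ℝ) + 1) ∧ 2 < Real.sqrt ((N : ℝ) + 1) := by
  refine ⟨N₀ + (⌈|M|⌉₊ + 3) ^ 2, Nat.le_add_right _ _, ?_, ?_⟩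
  · have h1 : |M| < Real.sqrt (((N₀ + (⌈|M|⌉₊ + 3) ^ 2 : ℕ) : ℝ) + 1) := by
      rw [Real.lt_sqrt (abs_nonneg M)]
      push_cast
      nlinarith [Nat.le_ceil (|M|), abs_nonneg M, (Nat.cast_nonneg N₀ : (0:ℝ) ≤ N₀)]
    exact (le_abs_self M).trans_lt h1
  · rw [Real.lt_sqrt (by norm_num)]
    push_cast
    nlinarith [(Nat.cast_nonneg N₀ : (0:ℝ) ≤ N₀), (Nat.cast_nonneg ⌈|M|⌉₊ : (0:ℝ) ≤ ⌈|M|⌉₊)]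

/-! ## §3 Load-bearing: the RANDOM initial law (energy conservation alone is blind)

`EnergyCurrentTailsSure`: the crux with the expectation under the local Gibbs law replaced by a
sure statement over all configurations of bounded energy per particle (the only a priori
information the deterministic flow propagates).  FALSE: one sphere carrying the energy of all. -/

/-- The crux WITHOUT the random law: cubic uniform integrability for every configuration whose
kinetic energy per particle is at most `E₀`. -/
def EnergyCurrentTailsSure : Prop :=
  ∀ E₀ : ℝ, 0 < E₀ → ∀ ε : ℝ, 0 < ε → ∃ M : ℝ, ∃ N₀ : ℕ, ∀ N : ℕ, N₀ ≤ N →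
    ∀ z : Config (N + 1) (Fin 3) T3,
      ((N : ℝ) + 1)⁻¹ * ∑ i : Fin (N + 1), ‖(z i).2‖ ^ 2 ≤ E₀ → cubicTail N M z ≤ ε

/-- **Any proof must use the randomness of the data (energy conservation is blind to cubic
tails).**  Witness: `fastConfig N √(N+1)` has energy `1` per particle and cubic tail `√(N+1)`. -/
theorem energyCurrentTails_false_without_randomness : ¬ EnergyCurrentTailsSure := by
  intro h
  obtain ⟨M, N₀, hMN⟩ := h 1 one_pos 1 one_pos
  -- enlarge the cut-off to a nonnegative one (monotonicity is not needed: we pick N large)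
  obtain ⟨N, hN₀, hMN', h2⟩ := exists_sqrt_gt (max M 0) N₀
  have hM0 : (0 : ℝ) ≤ max M 0 := le_max_right _ _
  have key := hMN N hN₀ (fastConfig N (Real.sqrt ((N : ℝ) + 1))) (by
    rw [energy_fastConfig N _ (Real.sqrt_nonneg _), Real.sq_sqrt (by positivity),
      inv_mul_cancel₀ (by positivity)])
  -- the tail at cut-off `M` dominates the tail at cut-off `max M 0`
  have hmono : cubicTail N (max M 0) (fastConfig N (Real.sqrt ((N : ℝ) + 1))) ≤
      cubicTail N M (fastConfig N (Real.sqrt ((N : ℝ) + 1))) := by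
    unfold cubicTail
    refine mul_le_mul_of_nonneg_left (Finset.sum_le_sum fun i _ => ?_) (by positivity)
    unfold tail3
    refine Set.indicator_le_indicator_of_subset (fun v (hv : max M 0 < ‖v‖) => ?_)
      (fun v => by positivity) _
    exact (le_max_left M 0).trans_lt hv
  rw [cubicTail_fastConfig_sqrt hM0 hMN'] at hmono
  linarith


/-! ### §3b The same inside the hard-sphere domain (admissible, non-overlapping witnesses) -/

/-- `cubicTail` only depends on the velocities. -/
theorem cubicTail_congr_vel {N : ℕ} (M : ℝ) {z z' : Config (N + 1) (Fin 3) T3}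
    (h : ∀ i, (z i).2 = (z' i).2) : cubicTail N M z = cubicTail N M z' := by
  unfold cubicTail
  simp [h]

/-- The focusing configuration placed at prescribed (non-overlapping) positions `x`. -/
def fastConfigAt {N : ℕ} (x : Fin (N + 1) → T3) (V : ℝ) : Config (N + 1) (Fin 3) T3 :=
  zipConfig (x, fun i => if i = 0 then V • e 0 else 0)

theorem fastConfigAt_vel {N : ℕ} (x : Fin (N + 1) → T3) (V : ℝ) (i : Fin (N + 1)) :
    (fastConfigAt x V i).2 = (fastConfig N V i).2 := by
  simp [fastConfigAt, fastConfig]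

theorem fastConfigAt_mem {σ : ℝ} {N : ℕ} {x : Fin (N + 1) → T3}
    (hx : ∀ i j, i ≠ j → hsDiameter σ N < Torus.euclidDist (x i) (x j)) (V : ℝ) :
    fastConfigAt x V ∈ hardSphereDomain (Torus.geometry (Fin 3)) (N + 1) (hsDiameter σ N) := by
  unfold fastConfigAt
  rw [zipConfig_mem_hardSphereDomain_iff]
  exact fun i j hij => (hx i j hij).le

/-- The crux WITHOUT the random law, over ADMISSIBLE configurations only (mutual distances
`≥ σ(N+1)^{-1/3}`) of kinetic energy `≤ E₀` per particle. -/
def EnergyCurrentTailsSureInDomain (σ : ℝ) : Prop :=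
  ∀ E₀ : ℝ, 0 < E₀ → ∀ ε : ℝ, 0 < ε → ∃ M : ℝ, ∃ N₀ : ℕ, ∀ N : ℕ, N₀ ≤ N →
    ∀ z ∈ hardSphereDomain (Torus.geometry (Fin 3)) (N + 1) (hsDiameter σ N),
      ((N : ℝ) + 1)⁻¹ * ∑ i : Fin (N + 1), ‖(z i).2‖ ^ 2 ≤ E₀ → cubicTail N M z ≤ ε

/-- **The sure version fails inside the hard-sphere domain too** (every `σ ≤ 1/2`, where admissible
positions exist for all `N`, `exists_config_hsDiameter_lt`): the hard core constrains positions,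
not velocities. -/
theorem energyCurrentTails_false_without_randomness_inDomain {σ : ℝ} (hσ2 : σ ≤ 1 / 2) :
    ¬ EnergyCurrentTailsSureInDomain σ := by
  intro h
  obtain ⟨M, N₀, hMN⟩ := h 1 one_pos 1 one_pos
  obtain ⟨N, hN₀, hMN', h2⟩ := exists_sqrt_gt (max M 0) N₀
  have hM0 : (0 : ℝ) ≤ max M 0 := le_max_right _ _
  obtain ⟨x, hx⟩ := exists_config_hsDiameter_lt hσ2 N
  have hvel : ∀ i, (fastConfigAt x (Real.sqrt ((N : ℝ) + 1)) i).2 =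
      (fastConfig N (Real.sqrt ((N : ℝ) + 1)) i).2 := fastConfigAt_vel x _
  have henergy : ((N : ℝ) + 1)⁻¹ *
      ∑ i : Fin (N + 1), ‖(fastConfigAt x (Real.sqrt ((N : ℝ) + 1)) i).2‖ ^ 2 ≤ 1 := by
    simp_rw [hvel]
    rw [energy_fastConfig N _ (Real.sqrt_nonneg _), Real.sq_sqrt (by positivity),
      inv_mul_cancel₀ (by positivity)]
  have key := hMN N hN₀ (fastConfigAt x (Real.sqrt ((N : ℝ) + 1))) (fastConfigAt_mem hx _) henergy
  rw [cubicTail_congr_vel M hvel] at key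
  have hmono : cubicTail N (max M 0) (fastConfig N (Real.sqrt ((N : ℝ) + 1))) ≤
      cubicTail N M (fastConfig N (Real.sqrt ((N : ℝ) + 1))) := by
    unfold cubicTail
    refine mul_le_mul_of_nonneg_left (Finset.sum_le_sum fun i _ => ?_) (by positivity)
    unfold tail3
    refine Set.indicator_le_indicator_of_subset (fun v (hv : max M 0 < ‖v‖) => ?_)
      (fun v => by positivity) _
    exact (le_max_left M 0).trans_lt hv
  rw [cubicTail_fastConfig_sqrt hM0 hMN'] at hmono
  linarith

/-! ## §4 Load-bearing: the GAUSSIAN velocity law (quadratic UI does not give cubic UI)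

`EnergyCurrentTailsOfQuadraticUI`: for families of probability laws on phase space, uniform
integrability of the KINETIC ENERGY (all that energy conservation, the `O(N)` entropy bound and the
convergence of the hydrodynamic fields can see) implies uniform integrability of the cubic
current.  FALSE: the two-point laws `(1 - q_N) δ_rest + q_N δ_fast`, `q_N = (N+1)^{-1/2}`, have
quadratic tails `≤ q_N → 0` at every cut-off and cubic tails `= 1` at every cut-off. -/

/-- The crux WITHOUT the Gibbsian form of the law: cubic UI from quadratic UI. -/
def EnergyCurrentTailsOfQuadraticUI : Prop :=
  ∀ P : (N : ℕ) → Measure (Config (N + 1) (Fin 3) T3), (∀ N, IsProbabilityMeasure (P N)) →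
    (∀ ε : ℝ, 0 < ε → ∃ M : ℝ, ∃ N₀ : ℕ, ∀ N : ℕ, N₀ ≤ N →
        ∫⁻ z, ENNReal.ofReal (quadTail N M z) ∂(P N) ≤ ENNReal.ofReal ε) →
    ∀ ε : ℝ, 0 < ε → ∃ M : ℝ, ∃ N₀ : ℕ, ∀ N : ℕ, N₀ ≤ N →
        ∫⁻ z, ENNReal.ofReal (cubicTail N M z) ∂(P N) ≤ ENNReal.ofReal ε

/-- The mixing weight `q_N = (√(N+1))⁻¹ ∈ (0, 1]`. -/
def qN (N : ℕ) : ℝ := (Real.sqrt ((N : ℝ) + 1))⁻¹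

theorem qN_pos (N : ℕ) : 0 < qN N := inv_pos.2 (Real.sqrt_pos.2 (by positivity))

theorem qN_le_one (N : ℕ) : qN N ≤ 1 := by
  unfold qN
  refine inv_le_one_of_one_le₀ ?_
  rw [show (1 : ℝ) = Real.sqrt 1 by simp]
  exact Real.sqrt_le_sqrt (by simp)

theorem qN_mul_sqrt (N : ℕ) : qN N * Real.sqrt ((N : ℝ) + 1) = 1 :=
  inv_mul_cancel₀ (Real.sqrt_pos.2 (by positivity)).ne'

/-- The two-point focusing law. -/
def twoPointLaw (N : ℕ) : Measure (Config (N + 1) (Fin 3) T3) :=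
  ENNReal.ofReal (1 - qN N) • Measure.dirac (restConfig N) +
    ENNReal.ofReal (qN N) • Measure.dirac (fastConfig N (Real.sqrt ((N : ℝ) + 1)))

instance isProbabilityMeasure_twoPointLaw (N : ℕ) : IsProbabilityMeasure (twoPointLaw N) := by
  refine ⟨?_⟩
  simp only [twoPointLaw, Measure.coe_add, Measure.coe_smul, Pi.add_apply, Pi.smul_apply,
    measure_univ, smul_eq_mul, mul_one]
  rw [← ENNReal.ofReal_add (by linarith [qN_le_one N]) (qN_pos N).le]
  simp

theorem lintegral_twoPointLaw (N : ℕ) (f : Config (N + 1) (Fin 3) T3 → ℝ≥0∞) :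
    ∫⁻ z, f z ∂(twoPointLaw N) =
      ENNReal.ofReal (1 - qN N) * f (restConfig N) +
        ENNReal.ofReal (qN N) * f (fastConfig N (Real.sqrt ((N : ℝ) + 1))) := by
  simp only [twoPointLaw, lintegral_add_measure, lintegral_smul_measure, lintegral_dirac,
    smul_eq_mul]

theorem lintegral_quadTail_twoPointLaw_le (N : ℕ) {M : ℝ} (hM : 0 ≤ M) :
    ∫⁻ z, ENNReal.ofReal (quadTail N M z) ∂(twoPointLaw N) ≤ ENNReal.ofReal (qN N) := by
  rw [lintegral_twoPointLaw, quadTail_restConfig N hM, ENNReal.ofReal_zero, mul_zero, zero_add]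
  calc ENNReal.ofReal (qN N) * ENNReal.ofReal (quadTail N M (fastConfig N (Real.sqrt ((N : ℝ) + 1))))
      ≤ ENNReal.ofReal (qN N) * 1 := by
        gcongr
        rw [← ENNReal.ofReal_one]
        refine ENNReal.ofReal_le_ofReal ((quadTail_fastConfig_le hM (Real.sqrt_nonneg _)).trans ?_)
        rw [Real.sq_sqrt (by positivity), inv_mul_cancel₀ (by positivity)]
    _ = ENNReal.ofReal (qN N) := mul_one _

theorem lintegral_cubicTail_twoPointLaw (N : ℕ) {M : ℝ} (hM : 0 ≤ M)
    (hMN : M < Real.sqrt ((N : ℝ) + 1)) :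
    ∫⁻ z, ENNReal.ofReal (cubicTail N M z) ∂(twoPointLaw N) = 1 := by
  rw [lintegral_twoPointLaw, cubicTail_restConfig N hM, ENNReal.ofReal_zero, mul_zero, zero_add,
    cubicTail_fastConfig_sqrt hM hMN, ← ENNReal.ofReal_mul (qN_pos N).le, qN_mul_sqrt,
    ENNReal.ofReal_one]

theorem qN_le_of_le {ε : ℝ} (hε : 0 < ε) {N : ℕ} (hN : ⌈ε⁻¹ ^ 2⌉₊ ≤ N) : qN N ≤ ε := by
  unfold qN
  have hε1 : ε⁻¹ ≤ Real.sqrt ((N : ℝ) + 1) := by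
    rw [Real.le_sqrt (inv_pos.2 hε).le (by positivity)]
    have : (⌈ε⁻¹ ^ 2⌉₊ : ℝ) ≤ N := by exact_mod_cast hN
    linarith [Nat.le_ceil (ε⁻¹ ^ 2)]
  calc (Real.sqrt ((N : ℝ) + 1))⁻¹ ≤ (ε⁻¹)⁻¹ := inv_anti₀ (inv_pos.2 hε) hε1
    _ = ε := inv_inv ε

/-- **Any proof must use more of the local Gibbs law than the uniform integrability of the
kinetic energy.**  The two-point focusing laws satisfy quadratic UI and violate cubic UI. -/
theorem energyCurrentTails_false_of_quadraticUI_only : ¬ EnergyCurrentTailsOfQuadraticUI := by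
  intro h
  have hq : ∀ ε : ℝ, 0 < ε → ∃ M : ℝ, ∃ N₀ : ℕ, ∀ N : ℕ, N₀ ≤ N →
      ∫⁻ z, ENNReal.ofReal (quadTail N M z) ∂(twoPointLaw N) ≤ ENNReal.ofReal ε := by
    intro ε hε
    refine ⟨0, ⌈ε⁻¹ ^ 2⌉₊, fun N hN => ?_⟩
    exact (lintegral_quadTail_twoPointLaw_le N le_rfl).trans
      (ENNReal.ofReal_le_ofReal (qN_le_of_le hε hN))
  obtain ⟨M, N₀, hMN⟩ := h twoPointLaw (fun N => isProbabilityMeasure_twoPointLaw N) hq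
    (1 / 2) (by norm_num)
  obtain ⟨N, hN₀, hMN', -⟩ := exists_sqrt_gt (max M 0) N₀
  have key := hMN N hN₀
  -- monotonicity of the tail in the cut-off: replace `M` by `max M 0`
  have hmono : ∫⁻ z, ENNReal.ofReal (cubicTail N (max M 0) z) ∂(twoPointLaw N) ≤
      ∫⁻ z, ENNReal.ofReal (cubicTail N M z) ∂(twoPointLaw N) := by
    refine lintegral_mono fun z => ENNReal.ofReal_le_ofReal ?_
    unfold cubicTail
    refine mul_le_mul_of_nonneg_left (Finset.sum_le_sum fun i _ => ?_) (by positivity)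
    unfold tail3
    refine Set.indicator_le_indicator_of_subset (fun v (hv : max M 0 < ‖v‖) => ?_)
      (fun v => by positivity) _
    exact (le_max_left M 0).trans_lt hv
  rw [lintegral_cubicTail_twoPointLaw N (le_max_right M 0) hMN'] at hmono
  have : (1 : ℝ≥0∞) ≤ ENNReal.ofReal (1 / 2) := hmono.trans key
  rw [← ENNReal.ofReal_one] at this
  have := (ENNReal.ofReal_le_ofReal_iff (by norm_num)).1 this
  norm_num at this

/-! ## §5 No pathwise maximum principle: one elastic collision doubles a sphere's kinetic energy -/

/-- **Complete energy transfer in one collision.** Impact direction `e₀`, incoming velocities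
`v = -a e₀`, `w = a e₁`: after the collision `v' = 0` and `w' = a e₁ - a e₀`, `|w'|² = 2a²`. -/
theorem reflectVel_focus (a : ℝ) :
    reflectVel (e 0) (-(a • e 0), a • e 1) = ((0 : V3), a • e 1 - a • e 0) := by
  have h00 : @inner ℝ V3 _ (e 0) (e 0) = 1 := by
    rw [real_inner_self_eq_norm_sq, norm_e, one_pow]
  have h10 : @inner ℝ V3 _ (e 1) (e 0) = 0 := by
    simp [e, EuclideanSpace.inner_single_left]
  have hc : @inner ℝ V3 _ (-(a • e 0) - a • e 1) (e 0) / ‖e 0‖ ^ 2 = -a := by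
    rw [norm_e, one_pow, div_one, inner_sub_left, inner_neg_left, inner_smul_left,
      inner_smul_left, h00, h10]
    simp
  unfold reflectVel
  simp only [hc, Prod.mk.injEq]
  constructor
  · simp [neg_smul]
  · rw [neg_smul, ← sub_eq_add_neg]

theorem norm_sq_focus (a : ℝ) : ‖a • e 1 - a • e 0‖ ^ 2 = 2 * a ^ 2 := by
  rw [EuclideanSpace.norm_sq_eq]
  simp [e, Fin.sum_univ_three]
  ring


/-- **General focusing step** (iterable): for perpendicular incoming velocities `v ⊥ w`, the
collision with impact direction `v` itself stops the first sphere and gives the second ALL the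
energy: `(v, w) ↦ (0, w + v)`, `|w + v|² = |v|² + |w|²`.  Since `w + v` can again be split as a sum
of two perpendicular vectors of equal length, binary collision trees focus the energy of `2^k`
spheres of speed `a` onto one sphere of speed `2^{k/2} a` (kinematics only; positions, scheduling
and the Liouville weight of such trees are the real issue). -/
theorem reflectVel_perp {v w : V3} (hv : v ≠ 0) (h : @inner ℝ V3 _ v w = 0) :
    reflectVel v (v, w) = ((0 : V3), w + v) := by
  have hvv : @inner ℝ V3 _ v v = ‖v‖ ^ 2 := real_inner_self_eq_norm_sq v
  have hn : ‖v‖ ^ 2 ≠ 0 := pow_ne_zero 2 (norm_ne_zero_iff.2 hv)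
  have hc : @inner ℝ V3 _ (v - w) v / ‖v‖ ^ 2 = 1 := by
    rw [inner_sub_left, real_inner_comm v w, h, sub_zero, hvv, div_self hn]
  unfold reflectVel
  simp only [hc, one_smul, sub_self]

theorem norm_sq_add_perp {v w : V3} (h : @inner ℝ V3 _ v w = 0) :
    ‖w + v‖ ^ 2 = ‖w‖ ^ 2 + ‖v‖ ^ 2 := by
  rw [norm_add_sq_real, real_inner_comm v w, h]
  ring


/-! ### §5b Kinematic focusing trees: `2^k` spheres of speed `a` ↦ one sphere of speed `2^{k/2} a` -/

/-- The focusing step for perpendicular incoming velocities, junk case `v = 0` included. -/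
theorem reflectVel_perp' {v w : V3} (h : @inner ℝ V3 _ v w = 0) :
    reflectVel v (v, w) = ((0 : V3), w + v) := by
  by_cases hv : v = 0
  · subst hv; simp [reflectVel]
  · exact reflectVel_perp hv h

/-- Collision-reachability of velocity multisets: repeatedly replace a pair `(v, w)` by its elastic
image under SOME impact direction (kinematics only — positions and schedules are not modelled). -/
inductive Reach : Multiset V3 → Multiset V3 → Prop
  | refl (s : Multiset V3) : Reach s s
  | collide (n v w : V3) (s : Multiset V3) :
      Reach (v ::ₘ w ::ₘ s) ((reflectVel n (v, w)).1 ::ₘ (reflectVel n (v, w)).2 ::ₘ s)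
  | trans {s t u : Multiset V3} : Reach s t → Reach t u → Reach s u

theorem Reach.add_right {s t : Multiset V3} (h : Reach s t) (u : Multiset V3) :
    Reach (s + u) (t + u) := by
  induction h with
  | refl s => exact Reach.refl _
  | collide n v w s =>
      have h' := Reach.collide n v w (s + u)
      simpa only [Multiset.cons_add] using h'
  | trans _ _ ih1 ih2 => exact ih1.trans ih2

theorem Reach.add_left {s t : Multiset V3} (h : Reach s t) (u : Multiset V3) :
    Reach (u + s) (u + t) := by
  simpa only [add_comm] using h.add_right u

/-- In `ℝ³` every vector has a unit vector orthogonal to it. -/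
theorem exists_unit_orthogonal (V : V3) : ∃ p : V3, ‖p‖ = 1 ∧ @inner ℝ V3 _ V p = 0 := by
  by_cases hV : V = 0
  · exact ⟨e 0, norm_e 0, by simp [hV]⟩
  · haveI : Fact (Module.finrank ℝ V3 = 2 + 1) :=
      ⟨by rw [finrank_euclideanSpace, Fintype.card_fin]⟩
    have hfin : Module.finrank ℝ (ℝ ∙ V)ᗮ = 2 := Submodule.finrank_orthogonal_span_singleton hV
    have hpos : 0 < Module.finrank ℝ (ℝ ∙ V)ᗮ := by rw [hfin]; norm_num
    obtain ⟨x, hx⟩ := (Module.finrank_pos_iff_exists_ne_zero).1 hpos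
    have hx0 : (x : V3) ≠ 0 := fun h => hx (Subtype.ext h)
    have hxV : @inner ℝ V3 _ V x = 0 :=
      (Submodule.mem_orthogonal_singleton_iff_inner_right).1 x.2
    refine ⟨‖(x : V3)‖⁻¹ • (x : V3), ?_, ?_⟩
    · rw [norm_smul, norm_inv, norm_norm, inv_mul_cancel₀ (norm_ne_zero_iff.2 hx0)]
    · rw [inner_smul_right, hxV, mul_zero]

/-- Every vector is the sum of two PERPENDICULAR vectors of equal length `|V|/√2`. -/
theorem exists_perp_split (V : V3) : ∃ c₁ c₂ : V3, V = c₁ + c₂ ∧ @inner ℝ V3 _ c₁ c₂ = 0 ∧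
    ‖c₁‖ = ‖V‖ / Real.sqrt 2 ∧ ‖c₂‖ = ‖V‖ / Real.sqrt 2 := by
  obtain ⟨p, hp1, hVp⟩ := exists_unit_orthogonal V
  have hpp : @inner ℝ V3 _ p p = 1 := by rw [real_inner_self_eq_norm_sq, hp1, one_pow]
  have hVV : @inner ℝ V3 _ V V = ‖V‖ ^ 2 := real_inner_self_eq_norm_sq V
  have hpV : @inner ℝ V3 _ p V = 0 := by rw [real_inner_comm, hVp]
  have h2 : Real.sqrt 2 ≠ 0 := by positivity
  have hs2 : Real.sqrt 2 ^ 2 = 2 := Real.sq_sqrt (by norm_num)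
  -- norms of (V ± |V| p)/2
  have hn : ∀ σs : ℝ, σs ^ 2 = 1 →
      ‖(2 : ℝ)⁻¹ • (V + (σs * ‖V‖) • p)‖ = ‖V‖ / Real.sqrt 2 := by
    intro σs hσs
    have hσn : ‖σs * ‖V‖‖ ^ 2 = ‖V‖ ^ 2 := by
      rw [Real.norm_eq_abs, sq_abs, mul_pow, hσs, one_mul]
    have h2n : ‖(2 : ℝ)⁻¹‖ ^ 2 = 4⁻¹ := by norm_num
    have hsq : ‖(2 : ℝ)⁻¹ • (V + (σs * ‖V‖) • p)‖ ^ 2 = (‖V‖ / Real.sqrt 2) ^ 2 := by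
      rw [norm_smul, mul_pow, norm_add_sq_real, inner_smul_right, hVp, mul_zero, norm_smul,
        mul_pow, hp1, hσn, h2n, div_pow, hs2]
      ring
    exact (sq_eq_sq₀ (norm_nonneg _) (by positivity)).1 hsq
  refine ⟨(2 : ℝ)⁻¹ • (V + (1 * ‖V‖) • p), (2 : ℝ)⁻¹ • (V + ((-1) * ‖V‖) • p), ?_, ?_,
    hn 1 (by norm_num), hn (-1) (by norm_num)⟩
  · rw [← smul_add]
    have : V + (1 * ‖V‖) • p + (V + (-1 * ‖V‖) • p) = (2 : ℝ) • V := by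
      rw [two_smul]; module
    rw [this, smul_smul]; norm_num
  · rw [inner_smul_left, inner_smul_right, inner_add_left, inner_add_right, inner_add_right,
      inner_smul_right, inner_smul_left, inner_smul_left, inner_smul_right, hVV, hVp, hpV, hpp]
    simp
    ring

/-- **Kinematic focusing trees.** For every `k` and every target velocity `V` there are `2^k`
velocities, all of speed `|V| / 2^{k/2}`, from which a sequence of elastic pair collisions (each
with a suitable impact direction) produces ONE sphere with velocity `V` and `2^k - 1` spheres at
rest.  (Velocities only: whether positions on `𝕋³` can realise the schedule without interference,
and with what Liouville weight, is exactly what the crux is about.) -/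
theorem focusing_tree (k : ℕ) : ∀ V : V3, ∃ s : Multiset V3, Multiset.card s = 2 ^ k ∧
    (∀ c ∈ s, ‖c‖ = ‖V‖ / Real.sqrt 2 ^ k) ∧ Reach s (V ::ₘ Multiset.replicate (2 ^ k - 1) 0) := by
  induction k with
  | zero =>
      intro V
      refine ⟨{V}, by simp, fun c hc => ?_, ?_⟩
      · rw [Multiset.mem_singleton.1 hc]; simp
      · simpa using Reach.refl {V}
  | succ k ih =>
      intro V
      obtain ⟨c₁, c₂, hV, hperp, hn1, hn2⟩ := exists_perp_split V
      obtain ⟨s₁, hcard1, hnorm1, hR1⟩ := ih c₁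
      obtain ⟨s₂, hcard2, hnorm2, hR2⟩ := ih c₂
      set Z : Multiset V3 := Multiset.replicate (2 ^ k - 1) 0 with hZ
      refine ⟨s₁ + s₂, ?_, ?_, ?_⟩
      · rw [Multiset.card_add, hcard1, hcard2, pow_succ]; ring
      · intro c hc
        have hsplit : ‖V‖ / Real.sqrt 2 ^ (k + 1) = (‖V‖ / Real.sqrt 2) / Real.sqrt 2 ^ k := by
          rw [pow_succ, div_div, mul_comm]
        rcases Multiset.mem_add.1 hc with h | h
        · rw [hnorm1 c h, hn1, hsplit]
        · rw [hnorm2 c h, hn2, hsplit]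
      · have R1 : Reach (s₁ + s₂) ((c₁ ::ₘ Z) + s₂) := hR1.add_right s₂
        have R2 : Reach ((c₁ ::ₘ Z) + s₂) ((c₁ ::ₘ Z) + (c₂ ::ₘ Z)) := hR2.add_left _
        have heq : (c₁ ::ₘ Z) + (c₂ ::ₘ Z) = c₁ ::ₘ c₂ ::ₘ (Z + Z) := by
          rw [Multiset.cons_add, Multiset.add_cons]
        have R3 : Reach (c₁ ::ₘ c₂ ::ₘ (Z + Z))
            ((reflectVel c₁ (c₁, c₂)).1 ::ₘ (reflectVel c₁ (c₁, c₂)).2 ::ₘ (Z + Z)) :=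
          Reach.collide c₁ c₁ c₂ (Z + Z)
        rw [reflectVel_perp' hperp] at R3
        simp only at R3
        have hfin : ((0 : V3) ::ₘ (c₂ + c₁) ::ₘ (Z + Z)) = V ::ₘ Multiset.replicate (2 ^ (k + 1) - 1) 0 := by
          rw [Multiset.cons_swap, add_comm c₂ c₁, ← hV]
          congr 1
          have h1 : 1 ≤ 2 ^ k := Nat.one_le_two_pow
          have h2 : 2 ^ (k + 1) - 1 = ((2 ^ k - 1) + (2 ^ k - 1)) + 1 := by
            have : 2 ^ (k + 1) = 2 * 2 ^ k := by ring
            omega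
          rw [h2, Multiset.replicate_succ, Multiset.replicate_add]
        rw [heq] at R2
        rw [hfin] at R3
        exact (R1.trans R2).trans R3

/-- The natural pathwise strengthening "the cubic tail of a colliding pair does not increase in an
elastic collision" (a maximum principle for the crux functional along every trajectory). -/
def CubicTailNonincreasing : Prop :=
  ∀ (n v w : V3) (M : ℝ),
    tail3 M (reflectVel n (v, w)).1 + tail3 M (reflectVel n (v, w)).2 ≤ tail3 M v + tail3 M w

/-- **No maximum principle**: with `a = 1`, cut-off `M = 6/5`, both incoming speeds are `1 ≤ M`
(tail `0`) but the outgoing sphere has speed `√2 > 6/5` (tail `2√2 > 0`). Energy focusing by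
binary collision trees is kinematically allowed; only its PROBABILITY under the evolved law can
save the crux. -/
theorem cubicTail_not_nonincreasing : ¬ CubicTailNonincreasing := by
  intro h
  have key := h (e 0) (-((1 : ℝ) • e 0)) ((1 : ℝ) • e 1) (6 / 5)
  rw [reflectVel_focus 1] at key
  have hv : tail3 (6 / 5) (-((1 : ℝ) • e 0)) = 0 :=
    tail3_of_le (by rw [norm_neg, norm_smul, norm_e]; norm_num)
  have hw : tail3 (6 / 5) ((1 : ℝ) • e 1) = 0 :=
    tail3_of_le (by rw [norm_smul, norm_e]; norm_num)
  have h0 : tail3 (6 / 5) (0 : V3) = 0 := tail3_zero _ (by norm_num)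
  have hn2 : ‖(1 : ℝ) • e 1 - (1 : ℝ) • e 0‖ ^ 2 = 2 := by rw [norm_sq_focus]; norm_num
  have hgt : (6 / 5 : ℝ) < ‖(1 : ℝ) • e 1 - (1 : ℝ) • e 0‖ := by
    rw [← abs_of_nonneg (norm_nonneg ((1 : ℝ) • e 1 - (1 : ℝ) • e 0)),
      ← abs_of_nonneg (show (0 : ℝ) ≤ 6 / 5 by norm_num), ← sq_lt_sq, hn2]
    norm_num
  have hw' : tail3 (6 / 5) ((1 : ℝ) • e 1 - (1 : ℝ) • e 0) =
      ‖(1 : ℝ) • e 1 - (1 : ℝ) • e 0‖ ^ 3 := tail3_of_lt hgt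
  rw [hv, hw, h0, hw'] at key
  have : (0 : ℝ) < ‖(1 : ℝ) • e 1 - (1 : ℝ) • e 0‖ ^ 3 := by positivity
  linarith

/-! ## §6 The exponential-moment (large-deviation) strengthening is false already at `t = 0` -/

/-- One-body shadow (re-export of the catalogued barrier conjunct): the cubic observable has NO
finite exponential moment under any Maxwellian. -/
theorem not_exists_expCubicMoment_maxwellian :
    ¬ ∃ θ : ℝ, 0 < θ ∧ ∃ lam : ℝ, 0 < lam ∧
      ∫⁻ v : V3, ENNReal.ofReal (Real.exp (lam * ‖v‖ ^ 3 - ‖v‖ ^ 2 / (2 * θ))) < ∞ := by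
  rintro ⟨θ, hθ, lam, hlam, h⟩
  rw [Literature.Barriers.AtomisticToContinuum.lintegral_exp_cubic_eq_top hθ hlam] at h
  exact lt_irrefl _ h


/-! ### §6b The `N`-body form at `t = 0`: under EVERY local Gibbs law the crux functional has no
exponential moment (so it cannot enter the window-LD / Varadhan currency of the route's other
cruxes, and the entropy inequality cannot truncate it — the catalogued barrier in the exact
currency of stmt-9235) -/

section GibbsExpMoment

variable {a₀ θ₀ : T3 → ℝ} {u₀ : T3 → V3}

theorem measurable_exp_tail3 (β M : ℝ) :
    Measurable fun w : V3 => ENNReal.ofReal (Real.exp (β * tail3 M w)) :=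
  (Real.measurable_exp.comp ((measurable_tail3 M).const_mul β)).ennreal_ofReal

/-- One body: `∫ exp(β 𝟙{M<|w|}|w|³) N(u, θ)(dw) = ∞` for every drift `u`, temperature `θ > 0`,
`β > 0` and cut-off `M` (drifted version of the barrier conjunct
`Literature.Barriers.AtomisticToContinuum.setLIntegral_exp_cubic_eq_top`). -/
theorem lintegral_exp_tail3_gaussMeasure_eq_top {θ : ℝ} (hθ : 0 < θ) (u : V3) {β : ℝ}
    (hβ : 0 < β) (M : ℝ) :
    ∫⁻ w, ENNReal.ofReal (Real.exp (β * tail3 M w)) ∂(gaussMeasure u θ) = ∞ := by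
  rw [← withDensity_localMaxwellian_eq_gaussMeasure hθ u,
    lintegral_withDensity_eq_lintegral_mul _
      (continuous_localMaxwellian 1 θ u).measurable.ennreal_ofReal (measurable_exp_tail3 β M)]
  -- constants
  set K : ℝ := (2 * Real.pi * θ) ^ (-(Module.finrank ℝ V3 : ℝ) / 2) with hK
  have hK0 : 0 < K := Real.rpow_pos_of_pos (by positivity) _
  set C : ℝ := K * Real.exp (-‖u‖ ^ 2 / θ) with hC
  have hC0 : 0 < C := mul_pos hK0 (Real.exp_pos _)
  have hMx : ∀ w : V3, localMaxwellian 1 θ u w = K * Real.exp (-‖w - u‖ ^ 2 / (2 * θ)) := by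
    intro w
    simp [localMaxwellian, hK]
  -- pointwise lower bound on the tail region
  have hpt : ∀ w ∈ {w : V3 | M < ‖w‖},
      ENNReal.ofReal C * ENNReal.ofReal (Real.exp (β * ‖w‖ ^ 3 - ‖w‖ ^ 2 / (2 * (θ / 2)))) ≤
        (fun v => ENNReal.ofReal (localMaxwellian 1 θ u v)) w *
          ENNReal.ofReal (Real.exp (β * tail3 M w)) := by
    intro w hw
    have hw' : M < ‖w‖ := hw
    simp only
    rw [← ENNReal.ofReal_mul hC0.le,
      ← ENNReal.ofReal_mul (localMaxwellian_nonneg zero_le_one hθ.le u w), hMx w, tail3_of_lt hw',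
      hC, mul_assoc, mul_assoc, ← Real.exp_add, ← Real.exp_add]
    refine ENNReal.ofReal_le_ofReal (mul_le_mul_of_nonneg_left (Real.exp_le_exp.2 ?_) hK0.le)
    have h2 : ‖w - u‖ ^ 2 ≤ 2 * ‖w‖ ^ 2 + 2 * ‖u‖ ^ 2 := by
      have h := norm_sub_le w u
      nlinarith [norm_nonneg (w - u), norm_nonneg w, norm_nonneg u, sq_nonneg (‖w‖ - ‖u‖)]
    have key : ‖w - u‖ ^ 2 / (2 * θ) ≤ ‖u‖ ^ 2 / θ + ‖w‖ ^ 2 / θ := by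
      rw [← add_div, div_le_div_iff₀ (by positivity) hθ]
      nlinarith
    have hθ2 : (2 * (θ / 2)) = θ := by ring
    rw [hθ2]
    have : -‖u‖ ^ 2 / θ + (β * ‖w‖ ^ 3 - ‖w‖ ^ 2 / θ) =
        β * ‖w‖ ^ 3 - (‖u‖ ^ 2 / θ + ‖w‖ ^ 2 / θ) := by ring
    rw [this, neg_div]
    linarith
  have hmeasI : Measurable fun w : V3 =>
      ENNReal.ofReal (Real.exp (β * ‖w‖ ^ 3 - ‖w‖ ^ 2 / (2 * (θ / 2)))) :=
    (Real.measurable_exp.comp (((measurable_norm.pow_const 3).const_mul β).sub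
      ((measurable_norm.pow_const 2).div_const _))).ennreal_ofReal
  refine top_le_iff.1 ?_
  calc (⊤ : ℝ≥0∞)
      = ENNReal.ofReal C * ∫⁻ w in {w : V3 | M < ‖w‖},
          ENNReal.ofReal (Real.exp (β * ‖w‖ ^ 3 - ‖w‖ ^ 2 / (2 * (θ / 2)))) := by
        rw [Literature.Barriers.AtomisticToContinuum.setLIntegral_exp_cubic_eq_top (half_pos hθ) hβ M,
          ENNReal.mul_top (by simpa using hC0)]
    _ = ∫⁻ w in {w : V3 | M < ‖w‖}, ENNReal.ofReal C *
          ENNReal.ofReal (Real.exp (β * ‖w‖ ^ 3 - ‖w‖ ^ 2 / (2 * (θ / 2)))) :=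
        (lintegral_const_mul _ hmeasI).symm
    _ ≤ ∫⁻ w in {w : V3 | M < ‖w‖}, (fun v => ENNReal.ofReal (localMaxwellian 1 θ u v)) w *
          ENNReal.ofReal (Real.exp (β * tail3 M w)) :=
        setLIntegral_mono' (measurableSet_lt measurable_const measurable_norm) hpt
    _ ≤ ∫⁻ w, (fun v => ENNReal.ofReal (localMaxwellian 1 θ u v)) w *
          ENNReal.ofReal (Real.exp (β * tail3 M w)) := setLIntegral_le_lintegral _ _
    _ = _ := rfl

/-- **`N` bodies, time `0`: `E_{λ_N} exp(β ∑ᵢ 𝟙{M<|vᵢ|}|vᵢ|³) = ∞`** for every local Gibbs law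
with continuous profiles (`a₀ > 0`, `θ₀ > 0`), every `σ ≤ 1/2`, every `N`, every `β > 0` and every
cut-off `M` (disintegration `lintegral_localGibbsMeasure` + the one-body divergence on sphere
`0`). -/
theorem lintegral_exp_sum_tail3_localGibbsMeasure_eq_top (ha : Continuous a₀) (hθ : Continuous θ₀)
    (hu : Continuous u₀) (ha0 : ∀ x, 0 < a₀ x) (hθ0 : ∀ x, 0 < θ₀ x) {σ : ℝ} (hσ2 : σ ≤ 1 / 2)
    (N : ℕ) {β : ℝ} (hβ : 0 < β) (M : ℝ) :
    ∫⁻ z, ENNReal.ofReal (Real.exp (β * ∑ i : Fin (N + 1), tail3 M (z i).2))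
      ∂(localGibbsMeasure σ a₀ u₀ θ₀ N) = ∞ := by
  haveI := isProbabilityMeasure_localGibbsMeasure ha hθ hu ha0 hθ0 hσ2 N
  set G : Config (N + 1) (Fin 3) T3 → ℝ≥0∞ :=
    fun z => ENNReal.ofReal (Real.exp (β * ∑ i : Fin (N + 1), tail3 M (z i).2)) with hG
  have hGm : Measurable G := by
    refine (Real.measurable_exp.comp (Measurable.const_mul ?_ β)).ennreal_ofReal
    exact Finset.measurable_sum _ fun i _ =>
      (measurable_tail3 M).comp (measurable_snd.comp (measurable_pi_apply i))
  have hmeas1 : Measurable fun w : V3 => ENNReal.ofReal (Real.exp (β * tail3 M w)) :=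
    measurable_exp_tail3 β M
  rw [lintegral_localGibbsMeasure ha hθ hu (fun x => (ha0 x).le) hθ0 σ N hGm]
  have hinner : ∀ x : Fin (N + 1) → T3, ∫⁻ v, G (zipConfig (x, v)) ∂velMeasure u₀ θ₀ x = ⊤ := by
    intro x
    refine top_le_iff.1 ?_
    have hle : ∀ v : Fin (N + 1) → V3,
        ENNReal.ofReal (Real.exp (β * tail3 M (v 0))) ≤ G (zipConfig (x, v)) := by
      intro v
      refine ENNReal.ofReal_le_ofReal (Real.exp_le_exp.2 (mul_le_mul_of_nonneg_left ?_ hβ.le))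
      simp only [zipConfig_apply]
      exact Finset.single_le_sum (fun i _ => tail3_nonneg M (v i)) (Finset.mem_univ 0)
    calc (⊤ : ℝ≥0∞)
        = ∫⁻ w, ENNReal.ofReal (Real.exp (β * tail3 M w)) ∂(gaussMeasure (u₀ (x 0)) (θ₀ (x 0))) :=
          (lintegral_exp_tail3_gaussMeasure_eq_top (hθ0 _) _ hβ M).symm
      _ = ∫⁻ v, ENNReal.ofReal (Real.exp (β * tail3 M (v 0))) ∂velMeasure u₀ θ₀ x := by
          unfold velMeasure
          exact ((measurePreserving_eval (fun i => gaussMeasure (u₀ (x i)) (θ₀ (x i))) 0).lintegral_comp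
            hmeas1).symm
      _ ≤ ∫⁻ v, G (zipConfig (x, v)) ∂velMeasure u₀ θ₀ x := lintegral_mono hle
  simp_rw [hinner]
  have hfm : Measurable fun x : Fin (N + 1) → T3 => ENNReal.ofReal
      ((canonicalPartition (Torus.geometry (Fin 3)) (hsDiameter σ N) (N + 1)
        (localGibbsProfile a₀ u₀ θ₀))⁻¹ * posWeight a₀ (hsDiameter σ N) (N + 1) x) :=
    ((measurable_posWeight ha _ _).const_mul _).ennreal_ofReal
  rw [lintegral_mul_const _ hfm, lintegral_posWeight_eq_one ha hθ hu (fun x => (ha0 x).le) hθ0 σ N,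
    one_mul]

/-- The exponential-moment strengthening of the crux at time `0` (the currency a window-LD /
entropy-inequality proof would need): for some `β > 0` the exponential moment of `β ∑ᵢ tailᵢ`
grows at most like `exp(ε(N+1))`. -/
def EnergyCurrentTailsExpMoment : Prop :=
  ∀ (a₀ θ₀ : T3 → ℝ) (u₀ : T3 → V3), Continuous a₀ → Continuous θ₀ → Continuous u₀ →
    (∀ x, 0 < a₀ x) → (∀ x, 0 < θ₀ x) →
    ∃ σ₀ : ℝ, 0 < σ₀ ∧ ∀ σ : ℝ, 0 < σ → σ < σ₀ → ∃ β : ℝ, 0 < β ∧ ∀ ε : ℝ, 0 < ε →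
      ∃ M : ℝ, ∃ N₀ : ℕ, ∀ N : ℕ, N₀ ≤ N →
        ∫⁻ z, ENNReal.ofReal (Real.exp (β * ∑ i : Fin (N + 1),
            Set.indicator {v : V3 | M < ‖v‖} (fun v => ‖v‖ ^ 3) (z i).2))
          ∂(localGibbsMeasure σ a₀ u₀ θ₀ N) ≤ ENNReal.ofReal (Real.exp (ε * ((N : ℝ) + 1)))

/-- **The exponential-moment (LD-currency) strengthening is false at `t = 0`** (homogeneous
profile `a₀ = 1`, `u₀ = 0`, `θ₀ = 1`; any `σ ≤ 1/2` in the alleged range). -/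
theorem energyCurrentTailsExpMoment_false : ¬ EnergyCurrentTailsExpMoment := by
  intro h
  obtain ⟨σ₀, hσ₀, hσ⟩ := h (fun _ => 1) (fun _ => 1) (fun _ => 0) continuous_const continuous_const
    continuous_const (fun _ => one_pos) (fun _ => one_pos)
  set σ : ℝ := min (σ₀ / 2) (1 / 2) with hσdef
  have hσpos : 0 < σ := lt_min (half_pos hσ₀) (by norm_num)
  have hσlt : σ < σ₀ := (min_le_left _ _).trans_lt (half_lt_self hσ₀)
  have hσ2 : σ ≤ 1 / 2 := min_le_right _ _
  obtain ⟨β, hβ, hε⟩ := hσ σ hσpos hσlt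
  obtain ⟨M, N₀, hN⟩ := hε 1 one_pos
  have key := hN N₀ le_rfl
  have htop := lintegral_exp_sum_tail3_localGibbsMeasure_eq_top (a₀ := fun _ => 1) (θ₀ := fun _ => 1)
    (u₀ := fun _ => 0) continuous_const continuous_const continuous_const (fun _ => one_pos)
    (fun _ => one_pos) hσ2 N₀ hβ M
  unfold tail3 at htop
  rw [htop] at key
  exact ENNReal.ofReal_ne_top (top_le_iff.1 key)

end GibbsExpMoment


/-! ## §7 Next attacks and targets (prose; refreshed every cycle)

* TARGETS: none yet (`payload.stuck_stubs = []`, no line picked).  When a skeleton is registered its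
  stubs become `-- Targets` here.
* NEXT REGIMES: (i) the two-temperature slab (θ₀ piecewise-smooth with a cold and a hot half): does
  any tree tool bound the hot tail fraction at `s > 0`?  (expected: no — same blindness); (ii) a typed
  `N + 1 = 2` bench: along the two-body flow on `𝕋³` the pair energy is conserved, so the crux holds
  with `M² = 2 E₀`-type cut-offs only in probability — compute `E tail(s)` exactly at equilibrium
  (invariance) and off equilibrium (explicit two-body scattering) to exhibit the FIRST non-trivial
  instance where `E tail(s) ≠ E tail(0)`; (iii) kit MD (event-driven, `N ∈ {10³,10⁴}`, shear/thermal
  profiles): can only confirm thin tails, low priority.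
* FOR PLANNERS: the equilibrium rung of Finding 2 is provable now; the LD-currency exclusion of §6b
  is importable once landed.
-/

end Summit.AtomisticToContinuum.HydrodynamicLimit.Cruxes.EnergyCurrentTails.Disproof

end
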